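import Summits.HodgeConjecture.HodgeConjecture.Theorems.F0P3cXiCentralIotaOfOrgans   -- ★ p850019 (B0): the five letters, `_holds` for O-RIGID∕O-ARCH∕O-ARCHψ, head
import HarnessLib

/-!
# Crux `H413`, line LH1 «ZENTRUM» — CENTRAL-τ AT ALL PLACES: the central half of the archimedean pin is paid at EVERY complex embedding `τ`
# (compact places included), and the print residue of CASIMIR-ι ∕ PIN-τ is «`qψ τ = ±1`»

Cell `hodgecm-mathlib` (D-0151), FLOOR 0, crux item H413 = `stmt-HodgeConjecture-24833` (`--supports`), route of record `HCCMUnconditional`; half A line LH1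
(closer stub `stub_S2sharp`, #80 S2♯), «ZENTRUM» chapter of LH1-plan (g4); seat LH1-p01 (g4), DEFAULT brick «CENTRAL-τ ALL PLACES» (bus 2026-09-02 07:0xZ).
THEOREMS ONLY (no `def`, no instance, no notation, no named fact, no `sorry`).  Everything is stated MODULO the one open organ O-SPLIT of the sub-leaf, taken
BY NAME as the hypothesis `hS : XiCentralCharSplitLetter` of ★ (B0) `F0P3cXiCentralIotaOfOrgans` (exactly as the ★ head `s2CentralIota_of_organs` does).
HC_CM is proved only modulo the 7 printed citations (2 remaining: hLiu418 = stmt-HodgeConjecture-24832, h413 = stmt-HodgeConjecture-24833) until rung 0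
closes; this file books nothing and discharges nothing booked (count-neutral in-house kit for LEAF ED. 4 pricing).

## The observation
The ★ head proves `a + b + c = 0` for Rogawski's triple AT THE FRAME'S EMBEDDING `ι`.  Its mechanism is place-free up to the last line: Z2's central character
`ψ_P`, O-ARCHψ, O-SPLIT and O-RIGID give that the automorphic character `c_ξ = η² · ψ³ · μω|_T` of the norm-one torus `T(𝔸)` is TRIVIAL ON THE WHOLE ARCHIMEDEAN
TORUS `T_∞ = ∏_w U(1)` (§1, the head's internal `harch'` made citable), and ★ O-ARCH `XiCentralCharArchExponentLetter` (p849968) is P-free bookkeeping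
quantified over an ARBITRARY embedding.  Hence (§2) `3·qψ τ + 2·(pη τ + t_τ) + 1 = 0` and `a_τ + b_τ + c_τ = 0` at EVERY `τ : L →+* ℂ` — the central half of the
archimedean pin at the COMPACT places as well, by the same in-house road (no packets, no trace formula).  §3 is pure arithmetic on ★ `ArchSignRecipe`:
given the central identity, `IsCohTrivial p q t ↔ q = ±1` and `a²+b²+c² = 2 ↔ q = ±1`; so (§4) modulo O-SPLIT the PRINT RESIDUE of both remaining
archimedean organs of the LH1 leaf — CASIMIR-ι (`a²+b²+c² = 2` at `ι`) and PIN-τ (`ξ.IsCohTrivialAt t_τ τ` at `τ ≠ ι`) — is exactly «`ξ.qψ τ = ±1`», the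
archimedean type of the `U(1)`-component `ψ` of `ξ`, token-free and `K_c`-free.

## What is proved (all modulo `hS : XiCentralCharSplitLetter`; frame = that of ★ `S2CentralIotaLetter`)
* §1 `etaSqPsiCubeMu_archTorus_eq_one_of_split` — `η(e u_y)² · ψ(e u_y)³ · μω(u_y) = 1` for every archimedean norm-one unit `y` (the hypothesis shape of ★
  `XiCentralCharArchExponentLetter`, verbatim).
* §2 `centralExponent_eq_zero_at_of_split` — `∀ τ, 3·ξ.qψ τ + 2·(ξ.pη τ + tOfArchType (archTypeOfRecord μω) τ) + 1 = 0`;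
  `centralSum_eq_zero_at_of_split` — `∀ τ a b c, rogTriple (ξ.pη τ) (ξ.qψ τ) (tOfArchType (archTypeOfRecord μω) τ) = (a,b,c) → a + b + c = 0` (at `τ = ι` this is
  ★ `S2CentralIotaLetter`'s conclusion; `s2CentralIota_of_split` re-derives the letter as a check).
* §3 (P-free arithmetic) `isCohTrivial_iff_of_centralExponent`, `q_eq_of_isCohTrivial`, `sq_sum_eq_two_iff_of_centralSum`.
* §4 `isCohTrivialAt_of_split_of_qψ` — `∀ τ, (ξ.qψ τ = 1 ∨ ξ.qψ τ = -1) → ξ.IsCohTrivialAt (tOfArchType (archTypeOfRecord μω) τ) τ` (PIN-τ's conclusion, and PIN-ι's,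
  from the print residue); `sq_sum_eq_two_iff_qψ_of_split` — `a²+b²+c² = 2 ↔ ξ.qψ ι = ±1` for the triple at any `τ` (CASIMIR-ι's conclusion ⇔ residue).

## References
* [Rogawski1990] J. Rogawski, Ann. of Math. Studies 123, §12.3 pp. 174–178 (archimedean parameters; `F_φ` at compact places p. 176), §13.3 p. 201, §14.6 pp. 242–243.
* [PlatonovRapinchuk1994] V. Platonov, A. Rapinchuk, §7.3 (weak approximation for tori) — inside O-RIGID ★ p849942.
* [Liu2021] Y. Liu, Camb. J. Math. 9 (2021), proof of Prop. 4.13 Case 1 («`χ_∞ = 1`») — inside O-ARCHψ ★ p849976.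
* Tree: ★ (B0) `Theorems/F0P3cXiCentralIotaOfOrgans` (p850019), ★ `Theorems/F0P3cXiCentralCharArchExponent` (p849968), ★ `Theorems/F0P3cRogTripleChiArithmetic` (p849139∕p849180).
-/

set_option autoImplicit false

-- the mandated namespace has the single-problem summit's repeated segment (`HodgeConjecture.HodgeConjecture`)
set_option linter.dupNamespace false

noncomputable section

open NumberField IsDedekindDomain MeasureTheory
open scoped Matrix ComplexOrder

namespace Summit.HodgeConjecture.HodgeConjecture.Cruxes.H413.F0P3cXiCentralAllPlaces

open Literature.NumberTheory.Automorphic Literature.NumberTheory.Automorphic.UnitaryGroup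
open Literature.NumberTheory.Automorphic.UnitaryGroup.CotangentForms
open Literature.NumberTheory.Automorphic.Arthur2013.Leaves.TECR
open Literature.NumberTheory.GaloisRepresentations
open Literature.NumberTheory.Rogawski1990
open Summit.HodgeConjecture.HodgeConjecture.Cruxes.H413.F0P3XiArchDataOfRecord
open Summit.HodgeConjecture.HodgeConjecture.Cruxes.H413.F0P3cRogTripleChiArithmetic
open Summit.HodgeConjecture.HodgeConjecture.Cruxes.H413.F0P3cXiCentralIotaOfOrgans

/-! ## §1 The automorphic torus character `η²ψ³μω|_T` is trivial on the WHOLE archimedean torus (the head's `harch'`, made citable) -/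

section Frame

variable (hS : XiCentralCharSplitLetter)
  (L : Type) [Field L] [NumberField L] [IsCMField L] (ι : L →+* ℂ) (H : Matrix (Fin 3) (Fin 3) L) (T : GL (Fin 3) ℂ)
  (hT : (T : Matrix (Fin 3) (Fin 3) ℂ)ᴴ * H.map ι * (T : Matrix (Fin 3) (Fin 3) ℂ) = Literature.Geometry.ComplexHyperbolic.BallModel.J)
  (hdef : ∀ τ' : L →+* ℂ, InfinitePlace.mk τ' ≠ InfinitePlace.mk ι → (H.map τ').PosDef)
  (h2 : 2 ≤ Module.finrank ℚ ↥(maximalRealSubfield L))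
  (μ : Measure (adelicGroupData (↥(maximalRealSubfield L)) L (IsCMField.complexConj L) 3 H).automorphicQuotient)
  [(adelicGroupData (↥(maximalRealSubfield L)) L (IsCMField.complexConj L) 3 H).IsAutomorphicMeasure μ]
  (μω : HeckeCharacter L) (hμu : μω.IsUnitary)
  (hμω : ∀ x : Literature.NumberTheory.GaloisRepresentations.ideleGroup ↥(maximalRealSubfield L),
    μω (AdeleRing.ideleBaseChange (↥(maximalRealSubfield L)) L x) = quadraticHeckeCharCM L x)
  (P : DiscreteAutomorphicRep (adelicGroupData (↥(maximalRealSubfield L)) L (IsCMField.complexConj L) 3 H) μ)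
  (hP : P.IsHolCotangentAt (cmArchSection L ι H T hT) (cmCompactFactor L ι H T hT) ∨
    P.IsAntiholCotangentAt (cmArchSection L ι H T hT) (cmCompactFactor L ι H T hT))
  (ξ : OneDimAutRepH L)
  (hmem : MemXiFamily P (transpose_map_cmConjRingHom_eq_of_frame L ι H T hT) (isUnit_det_of_frame L ι H T hT) μω hμu ξ)

include hS hdef h2 hμω hP hmem

/-- **`c_ξ = η² · ψ³ · μω|_T` is trivial on the archimedean torus `T_∞`** — for every archimedean norm-one unit `y`, read through ★ `cmAdelicOneEquivRelNormOne` ∕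
★ `adelicOneEquivTorus` (the hypothesis shape of ★ `XiCentralCharArchExponentLetter`, verbatim).  Proof = the ★ head `s2CentralIota_of_organs` up to its last step:
Z2's `ψ_P` (★ `exists_centralCharacter_adelicCenter`), O-ARCHψ (★ `cotangentArchCentreTrivialLetter_holds`), O-SPLIT (`hS`) and O-RIGID (★ `torusCharRigidSplitLetter_holds`)
applied to `θ = (ψ_P ∘ e⁻¹) · c_ξ⁻¹`. [cite: Rogawski1990, §12.3 pp. 174–178; §13.3 p. 201] [cite: PlatonovRapinchuk1994, §7.3] -/
theorem etaSqPsiCubeMu_archTorus_eq_one_of_split (y : ↥(relNormOneInfUnits (↥(maximalRealSubfield L)) L)) :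
    ξ.η (adelicOneEquivTorus (↥(maximalRealSubfield L)) L (IsCMField.complexConj L)
        ((cmAdelicOneEquivRelNormOne L).symm (relNormOneInfToIdeles (↥(maximalRealSubfield L)) L y))) ^ 2 *
      ξ.ψ (adelicOneEquivTorus (↥(maximalRealSubfield L)) L (IsCMField.complexConj L)
        ((cmAdelicOneEquivRelNormOne L).symm (relNormOneInfToIdeles (↥(maximalRealSubfield L)) L y))) ^ 3 *
      μω (((cmAdelicOneEquivRelNormOne L).symm (relNormOneInfToIdeles (↥(maximalRealSubfield L)) L y) :
        ↥(adelicOne (↥(maximalRealSubfield L)) L (IsCMField.complexConj L))) : ideleGroup L) = 1 := by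
  have hA : CotangentArchCentreTrivialLetter := cotangentArchCentreTrivialLetter_holds
  have hR : TorusCharRigidSplitLetter := torusCharRigidSplitLetter_holds
  classical
  -- (Z2) the central character of `P`
  obtain ⟨ψ, -, hψc, hψ1, hψ⟩ := DiscreteAutomorphicRep.exists_centralCharacter_adelicCenter P
  -- (O-ARCHψ) `ψ` is trivial on the archimedean centre
  have harch := hA L ι H T hT hdef h2 μ P hP ψ hψ
  -- (O-SPLIT) `ψ = η²ψ³μ` on the local torus at every split place
  have hsplit := hS L ι H T hT hdef h2 μ μω hμu hμω P hP ψ hψ ξ hmem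
  -- the comparison character `θ = (ψ ∘ (T ≃ U(1))) · (η²ψ³μ|_T)⁻¹` on `T(𝔸)`
  set e := adelicOneEquivTorus (↥(maximalRealSubfield L)) L (IsCMField.complexConj L) with he
  let cξ : ↥(TorusDict.torus (IsCMField.complexConj L)) → ℂˣ := fun t =>
    ξ.η t ^ 2 * ξ.ψ t ^ 3 * μω ((t : ↥(TorusDict.torus (IsCMField.complexConj L))) : ideleGroup L)
  have cξ_mul : ∀ s t, cξ (s * t) = cξ s * cξ t := by
    intro s t
    simp only [cξ, map_mul, Subgroup.coe_mul]
    apply Units.ext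
    simp only [Units.val_mul, Units.val_pow_eq_pow_val]
    ring
  let θ : ↥(TorusDict.torus (IsCMField.complexConj L)) →* ℂˣ :=
    { toFun := fun t => ψ (e.symm t) * (cξ t)⁻¹
      map_one' := by simp only [cξ, map_one, Subgroup.coe_one, one_pow, one_mul, inv_one]
      map_mul' := by
        intro s t
        rw [map_mul, map_mul, cξ_mul]
        apply Units.ext
        simp only [Units.val_mul, Units.val_inv_eq_inv_val]
        ring }
  have hθ_apply : ∀ t, θ t = ψ (e.symm t) * (cξ t)⁻¹ := fun t => rfl
  -- continuity of `θ`
  have hθc : Continuous (fun t => ((θ t : ℂˣ) : ℂ)) := by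
    have hc1 : Continuous fun t : ↥(TorusDict.torus (IsCMField.complexConj L)) => ((ψ (e.symm t) : ℂˣ) : ℂ) :=
      hψc.comp (continuous_adelicOneEquivTorus_symm (↥(maximalRealSubfield L)) L (IsCMField.complexConj L))
    have hc2 : Continuous fun t : ↥(TorusDict.torus (IsCMField.complexConj L)) => ((cξ t : ℂˣ) : ℂ) := by
      have hη : Continuous fun t : ↥(TorusDict.torus (IsCMField.complexConj L)) => ((ξ.η t : ℂˣ) : ℂ) :=
        Units.continuous_val.comp (map_continuous ξ.η)
      have hψ' : Continuous fun t : ↥(TorusDict.torus (IsCMField.complexConj L)) => ((ξ.ψ t : ℂˣ) : ℂ) :=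
        Units.continuous_val.comp (map_continuous ξ.ψ)
      have hμ : Continuous fun t : ↥(TorusDict.torus (IsCMField.complexConj L)) =>
          ((μω ((t : ↥(TorusDict.torus (IsCMField.complexConj L))) : ideleGroup L) : ℂˣ) : ℂ) :=
        Units.continuous_val.comp ((map_continuous μω).comp continuous_subtype_val)
      have : (fun t : ↥(TorusDict.torus (IsCMField.complexConj L)) => ((cξ t : ℂˣ) : ℂ)) =
          fun t => ((ξ.η t : ℂˣ) : ℂ) ^ 2 * ((ξ.ψ t : ℂˣ) : ℂ) ^ 3 *
            ((μω ((t : ↥(TorusDict.torus (IsCMField.complexConj L))) : ideleGroup L) : ℂˣ) : ℂ) := by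
        funext t; simp only [cξ, Units.val_mul, Units.val_pow_eq_pow_val]
      rw [this]
      exact ((hη.pow 2).mul (hψ'.pow 3)).mul hμ
    have : (fun t => ((θ t : ℂˣ) : ℂ)) = fun t => ((ψ (e.symm t) : ℂˣ) : ℂ) * (((cξ t : ℂˣ) : ℂ))⁻¹ := by
      funext t; rw [hθ_apply, Units.val_mul, Units.val_inv_eq_inv_val]
    rw [this]
    exact hc1.mul (hc2.inv₀ fun t => (cξ t).ne_zero)
  -- automorphy of `θ`
  have hθaut : ∀ t : ↥(TorusDict.torus (IsCMField.complexConj L)), (t : ideleGroup L) ∈ principalIdeles L → θ t = 1 := by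
    intro t ht
    have h1 : ψ (e.symm t) = 1 :=
      hψ1 _ (adelicCenter_mem_range_toAdelic (↥(maximalRealSubfield L)) L (IsCMField.complexConj L) 3 H (e.symm t)
        (by rw [he, coe_adelicOneEquivTorus_symm]; exact ht))
    have h2' : cξ t = 1 := by
      simp only [cξ, ξ.hη t ht, ξ.hψ t ht, μω.map_principal ht, one_pow, one_mul]
    rw [hθ_apply, h1, h2', inv_one, one_mul]
  -- triviality of `θ` at split places
  have hθsplit : ∀ v : HeightOneSpectrum (𝓞 ↥(maximalRealSubfield L)),
      (∃ w : PlacesOver L v, IsCMField.complexConj L • w.1 ≠ w.1) →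
      ∀ t : ↥(normOneUnits (conjLocal L (IsCMField.complexConj L) v)), θ (locTorusIncl L (IsCMField.complexConj L) v t) = 1 := by
    intro v hs t
    rw [hθ_apply, hsplit v hs t]
    exact mul_inv_cancel _
  -- (O-RIGID) `θ = 1`, i.e. `ψ = η²ψ³μ` on all of `T(𝔸)`; read it on the archimedean torus with (O-ARCHψ)
  have hθ1 : θ = 1 := hR L θ hθc hθaut hθsplit
  set u := (cmAdelicOneEquivRelNormOne L).symm (relNormOneInfToIdeles (↥(maximalRealSubfield L)) L y) with hu
  have h := DFunLike.congr_fun hθ1 (e u)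
  rw [hθ_apply, MonoidHom.one_apply, MulEquiv.symm_apply_apply, harch y, one_mul, inv_eq_one] at h
  simpa only [cξ, he, coe_adelicOneEquivTorus] using h

/-! ## §2 The central exponent vanishes at EVERY embedding `τ` (compact places included) -/

/-- **CENTRAL-τ, exponent form, ALL PLACES**: for every complex embedding `τ` of `L` (the frame's `ι` or not),
`3·qψ τ + 2·(pη τ + t_τ) + 1 = 0`, `t_τ = tOfArchType (archTypeOfRecord μω) τ` — §1 fed to ★ O-ARCH `xiCentralCharArchExponentLetter_holds` AT `τ` (its letter quantifies
the embedding arbitrarily). [cite: Rogawski1990, §12.3 pp. 174–178] -/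
theorem centralExponent_eq_zero_at_of_split (τ : L →+* ℂ) :
    3 * ξ.qψ τ + 2 * (ξ.pη τ + ArchSignRecipe.tOfArchType (archTypeOfRecord μω) τ) + 1 = 0 :=
  xiCentralCharArchExponentLetter_holds L τ ξ μω hμu hμω
    (etaSqPsiCubeMu_archTorus_eq_one_of_split hS L ι H T hT hdef h2 μ μω hμu hμω P hP ξ hmem)

/-- **CENTRAL-τ, triple form, ALL PLACES**: for every complex embedding `τ` of `L` the Rogawski triple `(a,b,c) = rogTriple (pη τ) (qψ τ) t_τ` has `a + b + c = 0`
(★ `rogCentralSum_eq`).  At `τ = ι` this is the conclusion of ★ `S2CentralIotaLetter`; at the compact places `τ ≠ ι` it is the CENTRAL HALF of organ PIN-τ of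
the LH1 leaf, paid by the same road. [cite: Rogawski1990, §12.3 pp. 174–178; §14.6 pp. 242–243] -/
theorem centralSum_eq_zero_at_of_split (τ : L →+* ℂ) (a b c : ℤ)
    (habc : ArchSignRecipe.rogTriple (ξ.pη τ) (ξ.qψ τ) (ArchSignRecipe.tOfArchType (archTypeOfRecord μω) τ) = (a, b, c)) :
    a + b + c = 0 := by
  have hexp := centralExponent_eq_zero_at_of_split hS L ι H T hT hdef h2 μ μω hμu hμω P hP ξ hmem τ
  have hsum := rogCentralSum_eq (ξ.pη τ) (ξ.qψ τ) (ArchSignRecipe.tOfArchType (archTypeOfRecord μω) τ)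
  unfold rogCentralSum at hsum
  rw [habc] at hsum
  simp only at hsum
  omega

end Frame

/-- Sanity re-derivation (a CHECK that §2 at `τ = ι` is the ★ target): ★ `S2CentralIotaLetter` from O-SPLIT via `centralSum_eq_zero_at_of_split` — the same
statement as the ★ head `s2CentralIota_of_organs`. [cite: Rogawski1990, §12.3 pp. 174–178] -/
theorem s2CentralIota_of_split (hS : XiCentralCharSplitLetter) : S2CentralIotaLetter :=
  fun L _ _ _ ι H T hT hdef h2 μ _ μω hμu hμω P hP ξ hmem a b c habc =>
    centralSum_eq_zero_at_of_split hS L ι H T hT hdef h2 μ μω hμu hμω P hP ξ hmem ι a b c habc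

/-! ## §3 Arithmetic (P-free): given the central identity, «coh-trivial» and «`a²+b²+c² = 2`» are both «`q = ±1`» -/

/-- Given `3q + 2(p+t) + 1 = 0`, the cohomological-weight condition ★ `IsCohTrivial p q t` (`rogTriple p q t = (1,0,−1)`, i.e. `(q, p+t) ∈ {(1,−2), (−1,1)}`,
★ `isCohTrivial_iff`) is equivalent to `q = 1 ∨ q = −1`. [cite: Rogawski1990, §12.3 p. 178] -/
theorem isCohTrivial_iff_of_centralExponent {p q t : ℤ} (h : 3 * q + 2 * (p + t) + 1 = 0) :
    ArchSignRecipe.IsCohTrivial p q t ↔ q = 1 ∨ q = -1 := by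
  rw [ArchSignRecipe.isCohTrivial_iff]
  omega

/-- The converse direction needs no central identity: coh-trivial ⇒ `q = ±1`. [cite: Rogawski1990, §12.3 p. 178] -/
theorem q_eq_of_isCohTrivial {p q t : ℤ} (h : ArchSignRecipe.IsCohTrivial p q t) : q = 1 ∨ q = -1 := by
  rw [ArchSignRecipe.isCohTrivial_iff] at h
  omega

/-- Given `a + b + c = 0` for `(a,b,c) = rogTriple p q t`, the weight-norm condition `a² + b² + c² = 2` (organ CASIMIR-ι's conclusion) is equivalent to `q = 1 ∨ q = −1`
(`{a,b,c} = {q, q+p+t+1, q+p+t}`; with `s = p+t`, `3q+2s+1 = 0` and `q² + (q+s+1)² + (q+s)² = 2` force `6q² = 6`). [cite: Rogawski1990, §12.3 p. 178] -/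
theorem sq_sum_eq_two_iff_of_centralSum {p q t a b c : ℤ} (habc : ArchSignRecipe.rogTriple p q t = (a, b, c)) (hsum : a + b + c = 0) :
    a ^ 2 + b ^ 2 + c ^ 2 = 2 ↔ q = 1 ∨ q = -1 := by
  -- the multiset `{a,b,c}` is `{q, q+s+1, q+s}` in both cases of the recipe
  have hcases : (a = q ∧ b = q + (p + t) + 1 ∧ c = q + (p + t)) ∨ (a = q + (p + t) + 1 ∧ b = q + (p + t) ∧ c = q) := by
    unfold ArchSignRecipe.rogTriple at habc
    split_ifs at habc with h
    · simp only [Prod.mk.injEq] at habc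
      exact Or.inl ⟨habc.1.symm, by omega, by omega⟩
    · simp only [Prod.mk.injEq] at habc
      exact Or.inr ⟨by omega, by omega, habc.2.2.symm⟩
  constructor
  · intro hn
    have hq2 : q ^ 2 = 1 := by
      rcases hcases with ⟨rfl, rfl, rfl⟩ | ⟨rfl, rfl, rfl⟩ <;> nlinarith [hsum, hn]
    have hfac : (q - 1) * (q + 1) = 0 := by nlinarith [hq2]
    rcases mul_eq_zero.mp hfac with h1 | h1
    · exact Or.inl (by omega)
    · exact Or.inr (by omega)
  · intro hq
    rcases hcases with ⟨rfl, rfl, rfl⟩ | ⟨rfl, rfl, rfl⟩ <;> rcases hq with rfl | rfl <;> nlinarith [hsum]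

/-! ## §4 Read-backs modulo O-SPLIT: PIN-τ ∕ PIN-ι and CASIMIR-ι reduce to the print residue «`qψ τ = ±1`» -/

section Residue

variable (hS : XiCentralCharSplitLetter)
  (L : Type) [Field L] [NumberField L] [IsCMField L] (ι : L →+* ℂ) (H : Matrix (Fin 3) (Fin 3) L) (T : GL (Fin 3) ℂ)
  (hT : (T : Matrix (Fin 3) (Fin 3) ℂ)ᴴ * H.map ι * (T : Matrix (Fin 3) (Fin 3) ℂ) = Literature.Geometry.ComplexHyperbolic.BallModel.J)
  (hdef : ∀ τ' : L →+* ℂ, InfinitePlace.mk τ' ≠ InfinitePlace.mk ι → (H.map τ').PosDef)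
  (h2 : 2 ≤ Module.finrank ℚ ↥(maximalRealSubfield L))
  (μ : Measure (adelicGroupData (↥(maximalRealSubfield L)) L (IsCMField.complexConj L) 3 H).automorphicQuotient)
  [(adelicGroupData (↥(maximalRealSubfield L)) L (IsCMField.complexConj L) 3 H).IsAutomorphicMeasure μ]
  (μω : HeckeCharacter L) (hμu : μω.IsUnitary)
  (hμω : ∀ x : Literature.NumberTheory.GaloisRepresentations.ideleGroup ↥(maximalRealSubfield L),
    μω (AdeleRing.ideleBaseChange (↥(maximalRealSubfield L)) L x) = quadraticHeckeCharCM L x)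
  (P : DiscreteAutomorphicRep (adelicGroupData (↥(maximalRealSubfield L)) L (IsCMField.complexConj L) 3 H) μ)
  (hP : P.IsHolCotangentAt (cmArchSection L ι H T hT) (cmCompactFactor L ι H T hT) ∨
    P.IsAntiholCotangentAt (cmArchSection L ι H T hT) (cmCompactFactor L ι H T hT))
  (ξ : OneDimAutRepH L)
  (hmem : MemXiFamily P (transpose_map_cmConjRingHom_eq_of_frame L ι H T hT) (isUnit_det_of_frame L ι H T hT) μω hμu ξ)

include hS hdef h2 hμω hP hmem

/-- **PIN-τ ∕ PIN-ι modulo O-SPLIT and the print residue**: at EVERY embedding `τ`, if the `U(1)`-component `ψ` of `ξ` has archimedean exponent `qψ τ = ±1`, then `ξ` is of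
cohomological type with trivial coefficients at `τ` w.r.t. `t_τ = tOfArchType (archTypeOfRecord μω) τ` (★ `OneDimAutRepH.IsCohTrivialAt`) — the conclusion of organ PIN-τ
of the LH1 leaf at `τ ≠ ι` (and of the old PIN-ι at `τ = ι`). [cite: Rogawski1990, §12.3 p. 176 and p. 178; §14.6 pp. 242–243] -/
theorem isCohTrivialAt_of_split_of_qψ (τ : L →+* ℂ) (hq : ξ.qψ τ = 1 ∨ ξ.qψ τ = -1) :
    ξ.IsCohTrivialAt (ArchSignRecipe.tOfArchType (archTypeOfRecord μω) τ) τ := by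
  unfold OneDimAutRepH.IsCohTrivialAt
  exact (isCohTrivial_iff_of_centralExponent
    (centralExponent_eq_zero_at_of_split hS L ι H T hT hdef h2 μ μω hμu hμω P hP ξ hmem τ)).mpr hq

/-- Conversely (no organ needed beyond ★): coh-trivial at `τ` ⇒ `qψ τ = ±1`; so modulo O-SPLIT, PIN-τ at `τ` ⇔ «`qψ τ = ±1`». [cite: Rogawski1990, §12.3 p. 178] -/
theorem isCohTrivialAt_iff_qψ_of_split (τ : L →+* ℂ) :
    ξ.IsCohTrivialAt (ArchSignRecipe.tOfArchType (archTypeOfRecord μω) τ) τ ↔ (ξ.qψ τ = 1 ∨ ξ.qψ τ = -1) := by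
  unfold OneDimAutRepH.IsCohTrivialAt
  exact isCohTrivial_iff_of_centralExponent
    (centralExponent_eq_zero_at_of_split hS L ι H T hT hdef h2 μ μω hμu hμω P hP ξ hmem τ)

/-- **CASIMIR-ι modulo O-SPLIT and the print residue**: for the triple at any `τ`, `a² + b² + c² = 2 ↔ qψ τ = ±1` (§2 + §3); at `τ = ι` the left side is the
conclusion of organ CASIMIR-ι of the LH1 leaf. [cite: Rogawski1990, §12.3 p. 178] -/
theorem sq_sum_eq_two_iff_qψ_of_split (τ : L →+* ℂ) (a b c : ℤ)
    (habc : ArchSignRecipe.rogTriple (ξ.pη τ) (ξ.qψ τ) (ArchSignRecipe.tOfArchType (archTypeOfRecord μω) τ) = (a, b, c)) :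
    a ^ 2 + b ^ 2 + c ^ 2 = 2 ↔ (ξ.qψ τ = 1 ∨ ξ.qψ τ = -1) :=
  sq_sum_eq_two_iff_of_centralSum habc
    (centralSum_eq_zero_at_of_split hS L ι H T hT hdef h2 μ μω hμu hμω P hP ξ hmem τ a b c habc)

end Residue

end Summit.HodgeConjecture.HodgeConjecture.Cruxes.H413.F0P3cXiCentralAllPlaces

end
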